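import Summits.QuantumFields.YangMills.Theorems.BalabanUVNodesN15CurvedGluingCubeDressedLoc
import HarnessLib

/-!
# Route «BalabanUVNodes» (cluster K4 «SpineRates»), Track-A DAG node N15 = NE2, BACKGROUND LAYER — THE DRESSED CUBE PROPAGATOR AT A LIVE BACKGROUND: TWO-SIDED LOCALIZED ROWS, RIGHT ENTRIES,
# AND `hloc` MODULO A LOCALITY DEFECT

Cell `pub-ymgap`, seat `pub-ymgap-dag-n15-w3` (WIDTH SEAT 3∕3 on node N15, director-ym №197 ∕ HUMAN RULING D-0149; plan `W-SEAT-START-LIST.md` §n15 item 3 — twenty-first piece: the rows of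
file 20's dressed cube in EXACTLY the shapes dag-n15-c's bundle FILE 55 `gluedLetters_of_cubeRows` consumes (`hG`, `hDG`, `hGE`: kernels `1_S(y)1_S(y′)·const·e^{−δd}`), plus the
locality hypothesis weakened to a defect).  `bears_on: R4∕N15 · K3⁷ SpineGivenEndpointR13SepCoPH (stmt-QuantumFields-20544)`.  Filed `--kind proof --supports stmt-QuantumFields-20544 --as
helper` — COUNT-NEUTRAL.  Theorems only; 0 `sorry`.  Imports BY NAME file 20 `…N15CurvedGluingCubeDressedLoc` (`dressed_eq_comp_add`, `fgrad∕bgrad_dressed_eq_comp_add`, `hasMaj_bgPairM_orig`;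
file 16 `fgrad_comp_dressed`∕`bgrad_comp_dressed`; file 17 `covLapM_add_eq_lapOp_sub`; dag-n15-c M1 `bgPairM`∕`hasMaj_unstackM`∕`unstackM_comp_bgPairM_eq`, B1a `bgSourceV`∕`bgPropV_comp`∕
`bgSourceV_fix`∕`isUnit_stepV`∕`hasMaj_stepV`, B2 `hasMaj_stack`∕`hasMaj_projO_comp`, FILE 47 `hasMaj_localize`; lit `neumann_majorant_wrow`, `hasMaj_comp_exp`); nothing in the tree is modified.

WHY.  FILE 55 asks of each cube propagator `G_□` rows localized on BOTH sides (`1_S(y)1_S(y′)`), the right entry `G_□∘E` (e.g. `E = ∇^{±*}`), and (FILE 45) the per-cube locality `hloc`.  For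
the dressed cube `X = pr₀(1 − Ĝ₀V̂)⁻¹Ĝ₀` of file 20: (i) INPUT localization is inherited from the flat cube's input cut-off `G₀ = G₀M_ψ` because `X̂∘Q` is B1a's source step with source
`Ĝ₀∘Q` (`bgPropV_comp`), so `X̂∘M_ψ = X̂`; with file 20's output localization this gives the two-sided rows (FILE 47 `hasMaj_localize`); (ii) the RIGHT entries `X∘Q`, `∇^±X∘Q` are the
same source step majorised by Neumann-with-decay from `G₀∘Q, ∇^±G₀∘Q ≤ β₂e^{−δd}` (a separate source constant: `hasMaj_bgSourceV₂`), smallness still `q c_r < 1`, `q = β(r_c + r_a)(1 + |J ⊕ J|)`;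
(iii) when the flat cube inverts `Δ` on the cube only up to a defect, `M_χΔG₀ = M_χ + E` (a transplanted cube, or the exponentially small nonlocal tail of the Landau term across the collar),
`X = G₀(1 + VX)` gives `M_χ(Δ − V)X = M_χ + E(1 + VX)` with `E(1 + VX) ≤ m_E(1 + Rβ(1 − qc_r)⁻¹c_r)e^{−ρd}`, `R = (r_c + r_a)(1 + |J ⊕ J|)`.

* §1 `bgPairM_comp` (`X̂∘Q = bgSourceV Ŝ (Ŝ∘Q) V̂`), `bgPairM_comp_eq_self`, `dressed_comp_eq_self` (input localization), ★★ `mulOp_comp_sub_speciesOpM_comp_dressed_of_defect`;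
* §2 `hasMaj_bgSourceV₂`; ★★ `hasMaj_bgPairM_comp`, `hasMaj_projO_dressed_comp` (right entries); ★★ `hasMaj_dressed_loc₂`, `hasMaj_fgrad_comp_dressed_loc₂`, `hasMaj_bgrad_comp_dressed_loc₂`
  (two-sided rows = FILE 55's `hG`∕`hDG` shapes); `hasMaj_V_dressed` (`V∘X ≤ Rβ(1 − qc_r)⁻¹e^{−ρd}`), `hasMaj_defect_comp` (`E∘(1 + VX)`);
* §3 BY NAME at `Δ_U + W`: `mulOp_comp_covLapM_add_comp_dressed_of_defect`, `hasMaj_dressed_covLapM_add_loc₂`.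

HONEST FRAMING ∕ LIMITS.  Finite-dimensional algebra + B1a's Neumann series over DISPLAYED letters (the flat cube `G₀`, its cut-offs `χ, ψ`, its entries and right entries, the defect `E`
— producers: dag-n15-a's N-programme ∕ dag-n15-e; not proved here); ONE grid (no η-defect); nothing of [B6]∕[B9] asserted ((2.91) p. 239, (2.133) p. 247, (3.42) p. 397, (3.62)–(3.65)
pp. 402–403 = SHAPES ∕ MECHANISM).  NE2⁺ NOT PRINTED, NOT proved; N15 NOT discharged; counts of record UNMOVED (typed 28∕28 · discharged 5∕27); one finite 𝕋⁴ at fixed ε — NOT infinite volume,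
NOT OS on ℝ⁴, NOT a mass gap, NOT Clay; R4 closes the conditional finite-𝕋⁴ rung `BalabanLadder.UV` only.  Restate-immune (no Theses import).
-/

set_option autoImplicit false

noncomputable section
open scoped BigOperators
open Finset

namespace Summit.QuantumFields.YangMills.BalabanUVNodes.N15.CurvedSpecies

open Literature.MathematicalPhysics.QuantumFieldTheory.Balaban1983to89
open Literature.MathematicalPhysics.QuantumFieldTheory.Balaban1983to89.B11SectG (BlockNorm HasMaj RowSum hasMaj_comp_exp)
open Literature.MathematicalPhysics.QuantumFieldTheory.Balaban1983to89.T4EtaRateCoeffDefect (diagK diagK_nonneg)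
open Literature.MathematicalPhysics.QuantumFieldTheory.Balaban1983to89.B6RandomWalk (Triangle254)
open Literature.MathematicalPhysics.QuantumFieldTheory.Balaban1983to89.B9SectDWeightedNeumann (WRow wrow_of_exp neumann_majorant_wrow)
open Literature.MathematicalPhysics.QuantumFieldTheory.Balaban1983to89.B6Prop26Gluing (mulOp mulOp_apply ind ind_nonneg ind_of_mem)
open Summit.QuantumFields.YangMills.BalabanUVNodes.N15.MatrixSpecies (mmulOp liftBlk liftEquiv liftEquiv_apply liftEquiv_symm_apply)
open Summit.QuantumFields.YangMills.BalabanUVNodes.N15.DerivDefect (exists_const_hasMaj_ofBlocks)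
open Summit.QuantumFields.YangMills.BalabanUVNodes.N15.BackgroundModel (kappa_ofBlocks)
open Summit.QuantumFields.YangMills.BalabanUVNodes.N15.BackgroundLayer (fgrad bgrad speciesOpM stack projO blkPair hasMaj_stack hasMaj_projO_comp unstackM bgPairM projO_none_bgPairM
  projO_some_bgPairM hasMaj_unstackM isUnit_stepV hasMaj_stepV hasMaj_bgPropV unstackM_comp_bgPairM_eq covLapM tCoefA tCoefC bgSourceV bgPropV bgPropV_comp bgSourceV_fix)
open Summit.QuantumFields.YangMills.BalabanUVNodes.N15.Gluing (lapOp loc_ofBlocks_eq_zero hasMaj_localize)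

variable {X ι J : Type} [Fintype X] [DecidableEq X] [Fintype ι] [DecidableEq ι] [Fintype J] [DecidableEq J] (τ : J → X ≃ X) (n : ℝ)
  {G₀ : (X × ι → ℝ) →ₗ[ℝ] (X × ι → ℝ)} {D : J ⊕ J → (X × ι → ℝ) →ₗ[ℝ] (X × ι → ℝ)} (C : X → Matrix ι ι ℝ) (A : J ⊕ J → X → Matrix ι ι ℝ)

/-! ## §1 Right compositions, input localization, `hloc` modulo a defect -/

section Algebra

omit [DecidableEq ι] [DecidableEq J] in
/-- `X̂∘Q` IS B1a's source step with the source `Ŝ∘Q = (G₀∘Q, (D_j∘Q)_j)`: `bgPairM G₀ D C A ∘ Q = bgSourceV Ŝ (stack (G₀∘Q) (D∘Q)) V̂`. [cite: Balaban1985BackgroundPropagators, (3.64)–(3.65) pp.402–403 (shape)] -/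
theorem bgPairM_comp [DecidableEq ι] [DecidableEq J] (Q : (X × ι → ℝ) →ₗ[ℝ] (X × ι → ℝ)) :
    bgPairM G₀ D C A ∘ₗ Q = bgSourceV (stack G₀ D) (stack (G₀ ∘ₗ Q) (fun j => D j ∘ₗ Q)) (unstackM C A) := by
  have hst : stack G₀ D ∘ₗ Q = stack (G₀ ∘ₗ Q) (fun j => D j ∘ₗ Q) :=
    LinearMap.ext fun v => funext fun p => by rcases p with ⟨y, _ | j⟩ <;> rfl
  rw [bgPairM, bgPropV_comp, hst]

/-- INPUT LOCALIZATION IS INHERITED: if `G₀∘Q = G₀` and `D_j∘Q = D_j` (e.g. `Q = M_ψ`, the flat cube's input cut-off) then `X̂∘Q = X̂`. [cite: Balaban1984PropagatorsII, (2.133) p.247 («for y′ ∈ 𝔅 ∩ T_□»: shape)] -/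
theorem bgPairM_comp_eq_self {Q : (X × ι → ℝ) →ₗ[ℝ] (X × ι → ℝ)} (hG : G₀ ∘ₗ Q = G₀) (hD : ∀ j, D j ∘ₗ Q = D j) : bgPairM G₀ D C A ∘ₗ Q = bgPairM G₀ D C A := by
  rw [bgPairM_comp, hG]
  simp_rw [hD]
  rfl

/-- … for the pair around a flat cube propagator with its quotients as derived pieces: `G₀∘Q = G₀` alone gives `(pr_jX̂)∘Q = pr_jX̂` for every component. [cite: Balaban1984PropagatorsII, (2.133) p.247 (shape)] -/
theorem dressed_comp_eq_self (hDf : ∀ μ, D (Sum.inl μ) = fgrad n (liftEquiv (τ μ) ι) ∘ₗ G₀) (hDb : ∀ μ, D (Sum.inr μ) = bgrad n (liftEquiv (τ μ) ι) ∘ₗ G₀)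
    {Q : (X × ι → ℝ) →ₗ[ℝ] (X × ι → ℝ)} (hG : G₀ ∘ₗ Q = G₀) (j : Option (J ⊕ J)) : (projO j ∘ₗ bgPairM G₀ D C A) ∘ₗ Q = projO j ∘ₗ bgPairM G₀ D C A := by
  have hD : ∀ j, D j ∘ₗ Q = D j := by
    rintro (μ | μ)
    · rw [hDf, LinearMap.comp_assoc, hG]
    · rw [hDb, LinearMap.comp_assoc, hG]
  rw [LinearMap.comp_assoc, bgPairM_comp_eq_self C A hG hD]

/-- ★★ **`hloc` MODULO A LOCALITY DEFECT**: if the flat cube propagator inverts `Δ` on the cube up to `E`, `M_χ∘Δ∘G₀ = M_χ + E` (a transplanted cube; the nonlocal tail of `Δ_a` across the collar),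
then `M_χ∘(Δ − V(c, a))∘X = M_χ + E∘(1 + V∘X)`. [cite: Balaban1984PropagatorsII, (2.91) p.239 (mechanism); Balaban1985BackgroundPropagators, (3.62)–(3.65) pp.402–403] -/
theorem mulOp_comp_sub_speciesOpM_comp_dressed_of_defect (Δ E : (X × ι → ℝ) →ₗ[ℝ] (X × ι → ℝ)) (χ : X × ι → ℝ) (hloc : mulOp χ ∘ₗ Δ ∘ₗ G₀ = mulOp χ + E)
    (hDf : ∀ μ, D (Sum.inl μ) = fgrad n (liftEquiv (τ μ) ι) ∘ₗ G₀) (hDb : ∀ μ, D (Sum.inr μ) = bgrad n (liftEquiv (τ μ) ι) ∘ₗ G₀)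
    (hunit : IsUnit (1 - LinearMap.toMatrix' (stack G₀ D ∘ₗ unstackM C A))) :
    mulOp χ ∘ₗ (Δ - speciesOpM τ n C A) ∘ₗ (projO none ∘ₗ bgPairM G₀ D C A) =
      mulOp χ + E ∘ₗ (LinearMap.id + speciesOpM τ n C A ∘ₗ (projO none ∘ₗ bgPairM G₀ D C A)) := by
  have hX := dressed_eq_comp_add τ n C A hDf hDb hunit
  have hassoc : mulOp χ ∘ₗ Δ ∘ₗ (G₀ ∘ₗ (LinearMap.id + speciesOpM τ n C A ∘ₗ (projO none ∘ₗ bgPairM G₀ D C A))) =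
      (mulOp χ ∘ₗ Δ ∘ₗ G₀) ∘ₗ (LinearMap.id + speciesOpM τ n C A ∘ₗ (projO none ∘ₗ bgPairM G₀ D C A)) := by
    simp only [LinearMap.comp_assoc]
  have h1 : mulOp χ ∘ₗ Δ ∘ₗ (projO none ∘ₗ bgPairM G₀ D C A) =
      (mulOp χ + E) ∘ₗ (LinearMap.id + speciesOpM τ n C A ∘ₗ (projO none ∘ₗ bgPairM G₀ D C A)) := by
    conv_lhs => rw [hX]
    rw [hassoc, hloc]
  rw [LinearMap.sub_comp, LinearMap.comp_sub, h1, LinearMap.add_comp, LinearMap.comp_add, LinearMap.comp_id]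
  abel

end Algebra

/-! ## §2 Majorants: right entries, two-sided rows, the defect term -/

section Rows

variable {g : B6.Geometry} (blk : X → g.Site) {σ cr : ℝ}

omit [DecidableEq X] [Fintype ι] [DecidableEq ι] [Fintype J] [DecidableEq J] in
/-- NEUMANN WITH DECAY FOR A SOURCE WITH ITS OWN CONSTANT: `Ĝ ≤ βe^{−δd}`, `Ŝ ≤ β₂e^{−δd}`, `V̂ ≤ diagK R`, `βRc_r < 1` ⟹ `bgSourceV Ĝ Ŝ V̂ ≤ β₂(1 − βRc_r)⁻¹e^{−ρd}` (B1a `hasMaj_bgSourceV` with the source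
constant decoupled from the step's). [cite: Balaban1985BackgroundPropagators, (3.64) p.403 (mechanism); Balaban1984PropagatorsII, (2.52)–(2.56) pp.232–233] -/
theorem hasMaj_bgSourceV₂ {X₁ X₂ : Type} [Fintype X₁] [Fintype X₂] [DecidableEq X₁] [DecidableEq X₂] (blk₁ : X₁ → g.Site) (blk₂ : X₂ → g.Site) (htri : Triangle254 g)
    (hd : ∀ a b : g.Site, 0 ≤ g.dist a b) (hrow : RowSum g σ cr) (hσ : 0 ≤ σ) {ρ δ β β₂ R : ℝ} (hρ : 0 ≤ ρ) (hρδ : ρ + σ ≤ δ) (hβ : 0 ≤ β) (hβ₂ : 0 ≤ β₂) (hR : 0 ≤ R)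
    {G S : (X₁ → ℝ) →ₗ[ℝ] (X₂ → ℝ)} {V : (X₂ → ℝ) →ₗ[ℝ] (X₁ → ℝ)}
    (hG : HasMaj (BlockNorm.ofBlocks g blk₁) (BlockNorm.ofBlocks g blk₂) G (fun y y' => β * Real.exp (-(δ * g.dist y y'))))
    (hS : HasMaj (BlockNorm.ofBlocks g blk₁) (BlockNorm.ofBlocks g blk₂) S (fun y y' => β₂ * Real.exp (-(δ * g.dist y y'))))
    (hV : HasMaj (BlockNorm.ofBlocks g blk₂) (BlockNorm.ofBlocks g blk₁) V (diagK fun _ => R)) (hq : β * R * cr < 1) :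
    HasMaj (BlockNorm.ofBlocks g blk₁) (BlockNorm.ofBlocks g blk₂) (bgSourceV G S V) (fun y y' => β₂ * (1 - β * R * cr)⁻¹ * Real.exp (-(ρ * g.dist y y'))) := by
  have hσδ : σ ≤ δ := by linarith
  have hfix := bgSourceV_fix (S := S) (isUnit_stepV blk₁ blk₂ hd hrow hσδ hβ hR hG hV hq)
  have hK := hasMaj_stepV blk₁ blk₂ hβ hG hV
  have hwrow : WRow g ρ (fun y y' => β * R * Real.exp (-(δ * g.dist y y'))) (β * R * cr) := wrow_of_exp hd hrow (mul_nonneg hβ hR) hρδ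
  have hS' : HasMaj (BlockNorm.ofBlocks g blk₁) (BlockNorm.ofBlocks g blk₂) S (fun y y' => β₂ * Real.exp (-(ρ * g.dist y y'))) :=
    hS.mono fun a b => mul_le_mul_of_nonneg_left (Real.exp_le_exp.mpr (by nlinarith [hd a b, hσ])) hβ₂
  obtain ⟨M₀, hM₀, hap⟩ := exists_const_hasMaj_ofBlocks (g := g) blk₁ blk₂ (bgSourceV G S V)
  have hq1 : (BlockNorm.ofBlocks g blk₂).κ * (β * R * cr) < 1 := by rw [kappa_ofBlocks, one_mul]; exact hq
  have key := neumann_majorant_wrow htri hd hρ (fun _ _ => mul_nonneg (mul_nonneg hβ hR) (Real.exp_nonneg _)) hwrow hβ₂ hM₀ hK hS' hfix hap hq1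
  refine key.mono fun a b => le_of_eq ?_
  rw [kappa_ofBlocks, one_mul]

/-- ★★ **THE RIGHT ENTRIES OF THE DRESSED CUBE PAIR**: `G₀, D_j ≤ βe^{−δd}` (the unit), `G₀∘Q, D_j∘Q ≤ β₂e^{−δd}` (the source), rows `r_c, r_a`, `q = β(r_c + r_a)(1 + |J ⊕ J|)`, `qc_r < 1` ⟹
`X̂∘Q ≤ β₂(1 − qc_r)⁻¹e^{−ρd}` — e.g. `Q = ∇^{±*}_ν`: the stack `(X∇*, (∇_μX∇*)_μ)`. [cite: Balaban1985BackgroundPropagators, (3.42) p.397 (entry 2: shape), (3.64)–(3.65) pp.402–403 (mechanism)] -/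
theorem hasMaj_bgPairM_comp (htri : Triangle254 g) (hd : ∀ a b : g.Site, 0 ≤ g.dist a b) (hrow : RowSum g σ cr) (hσ : 0 ≤ σ) {ρ δ β β₂ rC rA : ℝ} (hρ : 0 ≤ ρ) (hρδ : ρ + σ ≤ δ)
    (hβ : 0 ≤ β) (hβ₂ : 0 ≤ β₂) (hrC : 0 ≤ rC) (hrA : 0 ≤ rA) (hC : ∀ x i, ∑ k, |C x i k| ≤ rC) (hA : ∀ j x i, ∑ k, |A j x i k| ≤ rA) (Q : (X × ι → ℝ) →ₗ[ℝ] (X × ι → ℝ))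
    (hG : HasMaj (BlockNorm.ofBlocks g (liftBlk blk ι)) (BlockNorm.ofBlocks g (liftBlk blk ι)) G₀ (fun y y' => β * Real.exp (-(δ * g.dist y y'))))
    (hD : ∀ j, HasMaj (BlockNorm.ofBlocks g (liftBlk blk ι)) (BlockNorm.ofBlocks g (liftBlk blk ι)) (D j) (fun y y' => β * Real.exp (-(δ * g.dist y y'))))
    (hGQ : HasMaj (BlockNorm.ofBlocks g (liftBlk blk ι)) (BlockNorm.ofBlocks g (liftBlk blk ι)) (G₀ ∘ₗ Q) (fun y y' => β₂ * Real.exp (-(δ * g.dist y y'))))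
    (hDQ : ∀ j, HasMaj (BlockNorm.ofBlocks g (liftBlk blk ι)) (BlockNorm.ofBlocks g (liftBlk blk ι)) (D j ∘ₗ Q) (fun y y' => β₂ * Real.exp (-(δ * g.dist y y'))))
    (hq : β * ((rC + rA) * (1 + Fintype.card (J ⊕ J))) * cr < 1) :
    HasMaj (BlockNorm.ofBlocks g (liftBlk blk ι)) (BlockNorm.ofBlocks g (blkPair (liftBlk blk ι))) (bgPairM G₀ D C A ∘ₗ Q)
      (fun y y' => β₂ * (1 - β * ((rC + rA) * (1 + Fintype.card (J ⊕ J))) * cr)⁻¹ * Real.exp (-(ρ * g.dist y y'))) := by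
  have hR0 : 0 ≤ rC + rA := by positivity
  have hCt : ∀ x i, ∑ k, |C x i k| ≤ rC + rA := fun x i => (hC x i).trans (by linarith)
  have hAt : ∀ j x i, ∑ k, |A j x i k| ≤ rC + rA := fun j x i => (hA j x i).trans (by linarith)
  have hV := hasMaj_unstackM (g := g) blk (J := J ⊕ J) hR0 hCt hAt
  have hS := hasMaj_stack (liftBlk blk ι) (fun _ _ => mul_nonneg hβ (Real.exp_nonneg _)) hG hD
  have hSQ := hasMaj_stack (liftBlk blk ι) (fun _ _ => mul_nonneg hβ₂ (Real.exp_nonneg _)) hGQ hDQ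
  rw [bgPairM_comp]
  exact hasMaj_bgSourceV₂ (liftBlk blk ι) (blkPair (liftBlk blk ι)) htri hd hrow hσ hρ hρδ hβ hβ₂ (mul_nonneg hR0 (by positivity)) hS hSQ hV hq

/-- … componentwise: `(pr_jX̂)∘Q ≤ β₂(1 − qc_r)⁻¹e^{−ρd}` — `j = none`: ENTRY 2 `X∘Q`; `j = ±μ`: the mixed right entries `∇^±_μX∘Q` (file 16 `fgrad_comp_dressed`∕`bgrad_comp_dressed`).
[cite: Balaban1985BackgroundPropagators, (3.42) p.397 (shape); King1986, Prop. 3.9 (3.73) p.665 (separate derivative kernels: shape)] -/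
theorem hasMaj_projO_dressed_comp (htri : Triangle254 g) (hd : ∀ a b : g.Site, 0 ≤ g.dist a b) (hrow : RowSum g σ cr) (hσ : 0 ≤ σ) {ρ δ β β₂ rC rA : ℝ} (hρ : 0 ≤ ρ) (hρδ : ρ + σ ≤ δ)
    (hβ : 0 ≤ β) (hβ₂ : 0 ≤ β₂) (hrC : 0 ≤ rC) (hrA : 0 ≤ rA) (hC : ∀ x i, ∑ k, |C x i k| ≤ rC) (hA : ∀ j x i, ∑ k, |A j x i k| ≤ rA) (Q : (X × ι → ℝ) →ₗ[ℝ] (X × ι → ℝ))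
    (hG : HasMaj (BlockNorm.ofBlocks g (liftBlk blk ι)) (BlockNorm.ofBlocks g (liftBlk blk ι)) G₀ (fun y y' => β * Real.exp (-(δ * g.dist y y'))))
    (hD : ∀ j, HasMaj (BlockNorm.ofBlocks g (liftBlk blk ι)) (BlockNorm.ofBlocks g (liftBlk blk ι)) (D j) (fun y y' => β * Real.exp (-(δ * g.dist y y'))))
    (hGQ : HasMaj (BlockNorm.ofBlocks g (liftBlk blk ι)) (BlockNorm.ofBlocks g (liftBlk blk ι)) (G₀ ∘ₗ Q) (fun y y' => β₂ * Real.exp (-(δ * g.dist y y'))))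
    (hDQ : ∀ j, HasMaj (BlockNorm.ofBlocks g (liftBlk blk ι)) (BlockNorm.ofBlocks g (liftBlk blk ι)) (D j ∘ₗ Q) (fun y y' => β₂ * Real.exp (-(δ * g.dist y y'))))
    (hq : β * ((rC + rA) * (1 + Fintype.card (J ⊕ J))) * cr < 1) (j : Option (J ⊕ J)) :
    HasMaj (BlockNorm.ofBlocks g (liftBlk blk ι)) (BlockNorm.ofBlocks g (liftBlk blk ι)) ((projO j ∘ₗ bgPairM G₀ D C A) ∘ₗ Q)
      (fun y y' => β₂ * (1 - β * ((rC + rA) * (1 + Fintype.card (J ⊕ J))) * cr)⁻¹ * Real.exp (-(ρ * g.dist y y'))) := by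
  rw [LinearMap.comp_assoc]
  exact hasMaj_projO_comp (liftBlk blk ι) (hasMaj_bgPairM_comp C A blk htri hd hrow hσ hρ hρδ hβ hβ₂ hrC hrA hC hA Q hG hD hGQ hDQ hq) j

omit [Fintype X] [DecidableEq X] [Fintype ι] [DecidableEq ι] [Fintype J] [DecidableEq J] in
/-- a multiplier supported over `S` kills every input vanishing over `S`. [folklore] -/
theorem mulOp_eq_zero_of_vanish {S : Set g.Site} {ψX : X → ℝ} (hS : ∀ x, ψX x ≠ 0 → blk x ∈ S) (μ : X × ι → ℝ) (hμ : ∀ p : X × ι, liftBlk blk ι p ∈ S → μ p = 0) :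
    mulOp (fun p : X × ι => ψX p.1) μ = 0 := by
  funext p
  rw [mulOp_apply, Pi.zero_apply]
  by_cases h : ψX p.1 = 0
  · rw [h, zero_mul]
  · rw [hμ p (hS p.1 h), mul_zero]

/-- ★★ **ENTRY 0, TWO-SIDED LOCALIZED** (FILE 55's `hG` shape): the flat cube's output AND input cut-offs `G₀ = M_χG₀ = G₀M_ψ` (`supp χ, supp ψ` over `S`) pass to the dressed cube:
`pr₀X̂ ≤ 1_S(y)1_S(y′)·β(1 − qc_r)⁻¹·e^{−ρd}`. [cite: Balaban1984PropagatorsII, (2.133) p.247 («for y, y′ ∈ 𝔅 ∩ T_□»: shape); Balaban1985BackgroundPropagators, (3.65) p.403 (mechanism)] -/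
theorem hasMaj_dressed_loc₂ (htri : Triangle254 g) (hd : ∀ a b : g.Site, 0 ≤ g.dist a b) (hrow : RowSum g σ cr) (hσ : 0 ≤ σ) {ρ δ β rC rA : ℝ} (hρ : 0 ≤ ρ) (hρδ : ρ + σ ≤ δ)
    (hβ : 0 ≤ β) (hrC : 0 ≤ rC) (hrA : 0 ≤ rA) {S : Set g.Site} {χX ψX : X → ℝ} (hSχ : ∀ x, χX x ≠ 0 → blk x ∈ S) (hSψ : ∀ x, ψX x ≠ 0 → blk x ∈ S)
    (hGχ : mulOp (fun p : X × ι => χX p.1) ∘ₗ G₀ = G₀) (hGψ : G₀ ∘ₗ mulOp (fun p : X × ι => ψX p.1) = G₀)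
    (hC : ∀ x i, ∑ k, |C x i k| ≤ rC) (hA : ∀ j x i, ∑ k, |A j x i k| ≤ rA) (hDf : ∀ μ, D (Sum.inl μ) = fgrad n (liftEquiv (τ μ) ι) ∘ₗ G₀)
    (hDb : ∀ μ, D (Sum.inr μ) = bgrad n (liftEquiv (τ μ) ι) ∘ₗ G₀)
    (hG : HasMaj (BlockNorm.ofBlocks g (liftBlk blk ι)) (BlockNorm.ofBlocks g (liftBlk blk ι)) G₀ (fun y y' => β * Real.exp (-(δ * g.dist y y'))))
    (hD : ∀ j, HasMaj (BlockNorm.ofBlocks g (liftBlk blk ι)) (BlockNorm.ofBlocks g (liftBlk blk ι)) (D j) (fun y y' => β * Real.exp (-(δ * g.dist y y'))))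
    (hq : β * ((rC + rA) * (1 + Fintype.card (J ⊕ J))) * cr < 1) :
    HasMaj (BlockNorm.ofBlocks g (liftBlk blk ι)) (BlockNorm.ofBlocks g (liftBlk blk ι)) (projO none ∘ₗ bgPairM G₀ D C A)
      (fun y y' => ind S y * ind S y' * (β * (1 - β * ((rC + rA) * (1 + Fintype.card (J ⊕ J))) * cr)⁻¹ * Real.exp (-(ρ * g.dist y y')))) := by
  obtain ⟨hunit, hX⟩ := hasMaj_bgPairM_orig C A blk htri hd hrow hσ hρ hρδ hβ hrC hrA hC hA hG hD hq
  have hβX : 0 ≤ β * (1 - β * ((rC + rA) * (1 + Fintype.card (J ⊕ J))) * cr)⁻¹ := mul_nonneg hβ (inv_nonneg.2 (by linarith))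
  have hfac := dressed_eq_comp_add τ n C A hDf hDb hunit
  have hinp := dressed_comp_eq_self τ n C A hDf hDb hGψ none
  refine hasMaj_localize (liftBlk blk ι) (liftBlk blk ι) (fun a b => mul_nonneg hβX (Real.exp_nonneg _)) (fun μ p hp => ?_) (fun μ hμ => ?_)
    (hasMaj_projO_comp (liftBlk blk ι) hX none)
  · have hχ0 : χX p.1 = 0 := by by_contra h; exact hp (hSχ p.1 h)
    rw [hfac, ← hGχ]
    simp only [LinearMap.comp_apply, mulOp_apply, hχ0, zero_mul]
  · rw [← hinp, LinearMap.comp_apply, mulOp_eq_zero_of_vanish blk hSψ μ hμ, map_zero]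

/-- ★★ **ENTRY 1 (forward), TWO-SIDED LOCALIZED** (FILE 55's `hDG` shape, per `μ`): `∇⁺_μG₀ = M_ψ′∇⁺_μG₀` (outputs over `S`) and `G₀ = G₀M_ψ` (inputs over `S`) ⟹
`∇⁺_μ∘pr₀X̂ ≤ 1_S(y)1_S(y′)·β(1 − qc_r)⁻¹·e^{−ρd}`. [cite: Balaban1984PropagatorsII, (2.133) p.247 (shape); Balaban1985BackgroundPropagators, (3.65) p.403 (mechanism)] -/
theorem hasMaj_fgrad_comp_dressed_loc₂ (htri : Triangle254 g) (hd : ∀ a b : g.Site, 0 ≤ g.dist a b) (hrow : RowSum g σ cr) (hσ : 0 ≤ σ) {ρ δ β rC rA : ℝ} (hρ : 0 ≤ ρ)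
    (hρδ : ρ + σ ≤ δ) (hβ : 0 ≤ β) (hrC : 0 ≤ rC) (hrA : 0 ≤ rA) {S : Set g.Site} (μ : J) {ψ'X ψX : X → ℝ} (hSψ' : ∀ x, ψ'X x ≠ 0 → blk x ∈ S)
    (hSψ : ∀ x, ψX x ≠ 0 → blk x ∈ S) (hDψ : mulOp (fun p : X × ι => ψ'X p.1) ∘ₗ (fgrad n (liftEquiv (τ μ) ι) ∘ₗ G₀) = fgrad n (liftEquiv (τ μ) ι) ∘ₗ G₀)
    (hGψ : G₀ ∘ₗ mulOp (fun p : X × ι => ψX p.1) = G₀) (hC : ∀ x i, ∑ k, |C x i k| ≤ rC) (hA : ∀ j x i, ∑ k, |A j x i k| ≤ rA)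
    (hDf : ∀ μ, D (Sum.inl μ) = fgrad n (liftEquiv (τ μ) ι) ∘ₗ G₀) (hDb : ∀ μ, D (Sum.inr μ) = bgrad n (liftEquiv (τ μ) ι) ∘ₗ G₀)
    (hG : HasMaj (BlockNorm.ofBlocks g (liftBlk blk ι)) (BlockNorm.ofBlocks g (liftBlk blk ι)) G₀ (fun y y' => β * Real.exp (-(δ * g.dist y y'))))
    (hD : ∀ j, HasMaj (BlockNorm.ofBlocks g (liftBlk blk ι)) (BlockNorm.ofBlocks g (liftBlk blk ι)) (D j) (fun y y' => β * Real.exp (-(δ * g.dist y y'))))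
    (hq : β * ((rC + rA) * (1 + Fintype.card (J ⊕ J))) * cr < 1) :
    HasMaj (BlockNorm.ofBlocks g (liftBlk blk ι)) (BlockNorm.ofBlocks g (liftBlk blk ι)) (fgrad n (liftEquiv (τ μ) ι) ∘ₗ (projO none ∘ₗ bgPairM G₀ D C A))
      (fun y y' => ind S y * ind S y' * (β * (1 - β * ((rC + rA) * (1 + Fintype.card (J ⊕ J))) * cr)⁻¹ * Real.exp (-(ρ * g.dist y y')))) := by
  obtain ⟨hunit, hX⟩ := hasMaj_bgPairM_orig C A blk htri hd hrow hσ hρ hρδ hβ hrC hrA hC hA hG hD hq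
  have hβX : 0 ≤ β * (1 - β * ((rC + rA) * (1 + Fintype.card (J ⊕ J))) * cr)⁻¹ := mul_nonneg hβ (inv_nonneg.2 (by linarith))
  have hfac := fgrad_dressed_eq_comp_add τ n C A hDf hDb hunit μ
  have hinp := dressed_comp_eq_self τ n C A hDf hDb hGψ none
  have hcomp : HasMaj (BlockNorm.ofBlocks g (liftBlk blk ι)) (BlockNorm.ofBlocks g (liftBlk blk ι)) (fgrad n (liftEquiv (τ μ) ι) ∘ₗ (projO none ∘ₗ bgPairM G₀ D C A))
      (fun y y' => β * (1 - β * ((rC + rA) * (1 + Fintype.card (J ⊕ J))) * cr)⁻¹ * Real.exp (-(ρ * g.dist y y'))) := by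
    rw [fgrad_comp_dressed τ n C A hDf hunit μ]
    exact hasMaj_projO_comp (liftBlk blk ι) hX (some (Sum.inl μ))
  refine hasMaj_localize (liftBlk blk ι) (liftBlk blk ι) (fun a b => mul_nonneg hβX (Real.exp_nonneg _)) (fun v p hp => ?_) (fun v hv => ?_) hcomp
  · have hψ0 : ψ'X p.1 = 0 := by by_contra h; exact hp (hSψ' p.1 h)
    rw [hfac, ← hDψ]
    simp only [LinearMap.comp_apply, mulOp_apply, hψ0, zero_mul]
  · rw [← hinp, LinearMap.comp_apply, LinearMap.comp_apply, mulOp_eq_zero_of_vanish blk hSψ v hv, map_zero, map_zero]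

/-- ★★ **ENTRY 1 (backward), TWO-SIDED LOCALIZED**: `∇⁻_μG₀ = M_ψ′∇⁻_μG₀`, `G₀ = G₀M_ψ` ⟹ `∇⁻_μ∘pr₀X̂ ≤ 1_S(y)1_S(y′)·β(1 − qc_r)⁻¹·e^{−ρd}`.
[cite: Balaban1984PropagatorsII, (2.133) p.247 (shape); Balaban1985BackgroundPropagators, (3.65) p.403 (mechanism)] -/
theorem hasMaj_bgrad_comp_dressed_loc₂ (htri : Triangle254 g) (hd : ∀ a b : g.Site, 0 ≤ g.dist a b) (hrow : RowSum g σ cr) (hσ : 0 ≤ σ) {ρ δ β rC rA : ℝ} (hρ : 0 ≤ ρ)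
    (hρδ : ρ + σ ≤ δ) (hβ : 0 ≤ β) (hrC : 0 ≤ rC) (hrA : 0 ≤ rA) {S : Set g.Site} (μ : J) {ψ'X ψX : X → ℝ} (hSψ' : ∀ x, ψ'X x ≠ 0 → blk x ∈ S)
    (hSψ : ∀ x, ψX x ≠ 0 → blk x ∈ S) (hDψ : mulOp (fun p : X × ι => ψ'X p.1) ∘ₗ (bgrad n (liftEquiv (τ μ) ι) ∘ₗ G₀) = bgrad n (liftEquiv (τ μ) ι) ∘ₗ G₀)
    (hGψ : G₀ ∘ₗ mulOp (fun p : X × ι => ψX p.1) = G₀) (hC : ∀ x i, ∑ k, |C x i k| ≤ rC) (hA : ∀ j x i, ∑ k, |A j x i k| ≤ rA)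
    (hDf : ∀ μ, D (Sum.inl μ) = fgrad n (liftEquiv (τ μ) ι) ∘ₗ G₀) (hDb : ∀ μ, D (Sum.inr μ) = bgrad n (liftEquiv (τ μ) ι) ∘ₗ G₀)
    (hG : HasMaj (BlockNorm.ofBlocks g (liftBlk blk ι)) (BlockNorm.ofBlocks g (liftBlk blk ι)) G₀ (fun y y' => β * Real.exp (-(δ * g.dist y y'))))
    (hD : ∀ j, HasMaj (BlockNorm.ofBlocks g (liftBlk blk ι)) (BlockNorm.ofBlocks g (liftBlk blk ι)) (D j) (fun y y' => β * Real.exp (-(δ * g.dist y y'))))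
    (hq : β * ((rC + rA) * (1 + Fintype.card (J ⊕ J))) * cr < 1) :
    HasMaj (BlockNorm.ofBlocks g (liftBlk blk ι)) (BlockNorm.ofBlocks g (liftBlk blk ι)) (bgrad n (liftEquiv (τ μ) ι) ∘ₗ (projO none ∘ₗ bgPairM G₀ D C A))
      (fun y y' => ind S y * ind S y' * (β * (1 - β * ((rC + rA) * (1 + Fintype.card (J ⊕ J))) * cr)⁻¹ * Real.exp (-(ρ * g.dist y y')))) := by
  obtain ⟨hunit, hX⟩ := hasMaj_bgPairM_orig C A blk htri hd hrow hσ hρ hρδ hβ hrC hrA hC hA hG hD hq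
  have hβX : 0 ≤ β * (1 - β * ((rC + rA) * (1 + Fintype.card (J ⊕ J))) * cr)⁻¹ := mul_nonneg hβ (inv_nonneg.2 (by linarith))
  have hfac := bgrad_dressed_eq_comp_add τ n C A hDf hDb hunit μ
  have hinp := dressed_comp_eq_self τ n C A hDf hDb hGψ none
  have hcomp : HasMaj (BlockNorm.ofBlocks g (liftBlk blk ι)) (BlockNorm.ofBlocks g (liftBlk blk ι)) (bgrad n (liftEquiv (τ μ) ι) ∘ₗ (projO none ∘ₗ bgPairM G₀ D C A))
      (fun y y' => β * (1 - β * ((rC + rA) * (1 + Fintype.card (J ⊕ J))) * cr)⁻¹ * Real.exp (-(ρ * g.dist y y'))) := by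
    rw [bgrad_comp_dressed τ n C A hDb hunit μ]
    exact hasMaj_projO_comp (liftBlk blk ι) hX (some (Sum.inr μ))
  refine hasMaj_localize (liftBlk blk ι) (liftBlk blk ι) (fun a b => mul_nonneg hβX (Real.exp_nonneg _)) (fun v p hp => ?_) (fun v hv => ?_) hcomp
  · have hψ0 : ψ'X p.1 = 0 := by by_contra h; exact hp (hSψ' p.1 h)
    rw [hfac, ← hDψ]
    simp only [LinearMap.comp_apply, mulOp_apply, hψ0, zero_mul]
  · rw [← hinp, LinearMap.comp_apply, LinearMap.comp_apply, mulOp_eq_zero_of_vanish blk hSψ v hv, map_zero, map_zero]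

/-- THE COARSE `V∘X ≤ Rβ(1 − Rβc_r)⁻¹e^{−ρd}`, `R = (r_c + r_a)(1 + |J ⊕ J|)` (M1 `unstackM_comp_bgPairM_eq`: `V∘X = V̂∘X̂`; B1a `hasMaj_stepV`-type composition).
[cite: Balaban1985BackgroundPropagators, (3.63) p.402 (shape)] -/
theorem hasMaj_V_dressed (htri : Triangle254 g) (hd : ∀ a b : g.Site, 0 ≤ g.dist a b) (hrow : RowSum g σ cr) (hσ : 0 ≤ σ) {ρ δ β rC rA : ℝ} (hρ : 0 ≤ ρ) (hρδ : ρ + σ ≤ δ)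
    (hβ : 0 ≤ β) (hrC : 0 ≤ rC) (hrA : 0 ≤ rA) (hC : ∀ x i, ∑ k, |C x i k| ≤ rC) (hA : ∀ j x i, ∑ k, |A j x i k| ≤ rA)
    (hDf : ∀ μ, D (Sum.inl μ) = fgrad n (liftEquiv (τ μ) ι) ∘ₗ G₀) (hDb : ∀ μ, D (Sum.inr μ) = bgrad n (liftEquiv (τ μ) ι) ∘ₗ G₀)
    (hG : HasMaj (BlockNorm.ofBlocks g (liftBlk blk ι)) (BlockNorm.ofBlocks g (liftBlk blk ι)) G₀ (fun y y' => β * Real.exp (-(δ * g.dist y y'))))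
    (hD : ∀ j, HasMaj (BlockNorm.ofBlocks g (liftBlk blk ι)) (BlockNorm.ofBlocks g (liftBlk blk ι)) (D j) (fun y y' => β * Real.exp (-(δ * g.dist y y'))))
    (hq : β * ((rC + rA) * (1 + Fintype.card (J ⊕ J))) * cr < 1) :
    HasMaj (BlockNorm.ofBlocks g (liftBlk blk ι)) (BlockNorm.ofBlocks g (liftBlk blk ι)) (speciesOpM τ n C A ∘ₗ (projO none ∘ₗ bgPairM G₀ D C A))
      (fun y y' => (rC + rA) * (1 + Fintype.card (J ⊕ J)) * (β * (1 - β * ((rC + rA) * (1 + Fintype.card (J ⊕ J))) * cr)⁻¹) * Real.exp (-(ρ * g.dist y y'))) := by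
  obtain ⟨hunit, hX⟩ := hasMaj_bgPairM_orig C A blk htri hd hrow hσ hρ hρδ hβ hrC hrA hC hA hG hD hq
  have hR0 : 0 ≤ rC + rA := by positivity
  have hR : 0 ≤ (rC + rA) * (1 + Fintype.card (J ⊕ J)) := mul_nonneg hR0 (by positivity)
  have hCt : ∀ x i, ∑ k, |C x i k| ≤ rC + rA := fun x i => (hC x i).trans (by linarith)
  have hAt : ∀ j x i, ∑ k, |A j x i k| ≤ rC + rA := fun j x i => (hA j x i).trans (by linarith)
  have hV := hasMaj_unstackM (g := g) blk (J := J ⊕ J) hR0 hCt hAt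
  rw [← unstackM_comp_bgPairM_eq τ n G₀ C A hDf hDb hunit]
  have key := B11SectG.hasMaj_comp hV hX (fun _ _ => diagK_nonneg (fun _ => hR) _ _)
  refine key.mono fun a b => le_of_eq ?_
  rw [kappa_ofBlocks]
  simp only [one_mul]
  rw [DerivDefect.sum_diagK_mul]
  ring

/-- ★ **THE DEFECT TERM**: `E ≤ m_Ee^{−δd}` ⟹ `E∘(1 + V∘X) ≤ m_E(1 + Rβ(1 − Rβc_r)⁻¹c_r)e^{−ρd}` (lit `hasMaj_comp_exp` on `E∘(V∘X)` + the trivial `e^{−δd} ≤ e^{−ρd}`).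
[cite: Balaban1984PropagatorsII, (2.91) p.239 (mechanism), (2.52)–(2.56) pp.232–233] -/
theorem hasMaj_defect_comp (htri : Triangle254 g) (hd : ∀ a b : g.Site, 0 ≤ g.dist a b) (hrow : RowSum g σ cr) (hσ : 0 ≤ σ) {ρ δ β rC rA mE : ℝ} (hρ : 0 ≤ ρ) (hρδ : ρ + σ ≤ δ)
    (hβ : 0 ≤ β) (hrC : 0 ≤ rC) (hrA : 0 ≤ rA) (hmE : 0 ≤ mE) (hC : ∀ x i, ∑ k, |C x i k| ≤ rC) (hA : ∀ j x i, ∑ k, |A j x i k| ≤ rA) {E : (X × ι → ℝ) →ₗ[ℝ] (X × ι → ℝ)}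
    (hE : HasMaj (BlockNorm.ofBlocks g (liftBlk blk ι)) (BlockNorm.ofBlocks g (liftBlk blk ι)) E (fun y y' => mE * Real.exp (-(δ * g.dist y y'))))
    (hDf : ∀ μ, D (Sum.inl μ) = fgrad n (liftEquiv (τ μ) ι) ∘ₗ G₀) (hDb : ∀ μ, D (Sum.inr μ) = bgrad n (liftEquiv (τ μ) ι) ∘ₗ G₀)
    (hG : HasMaj (BlockNorm.ofBlocks g (liftBlk blk ι)) (BlockNorm.ofBlocks g (liftBlk blk ι)) G₀ (fun y y' => β * Real.exp (-(δ * g.dist y y'))))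
    (hD : ∀ j, HasMaj (BlockNorm.ofBlocks g (liftBlk blk ι)) (BlockNorm.ofBlocks g (liftBlk blk ι)) (D j) (fun y y' => β * Real.exp (-(δ * g.dist y y'))))
    (hq : β * ((rC + rA) * (1 + Fintype.card (J ⊕ J))) * cr < 1) :
    HasMaj (BlockNorm.ofBlocks g (liftBlk blk ι)) (BlockNorm.ofBlocks g (liftBlk blk ι)) (E ∘ₗ (LinearMap.id + speciesOpM τ n C A ∘ₗ (projO none ∘ₗ bgPairM G₀ D C A)))
      (fun y y' => mE * (1 + (rC + rA) * (1 + Fintype.card (J ⊕ J)) * (β * (1 - β * ((rC + rA) * (1 + Fintype.card (J ⊕ J))) * cr)⁻¹) * cr) *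
        Real.exp (-(ρ * g.dist y y'))) := by
  have hVX := hasMaj_V_dressed τ n C A blk htri hd hrow hσ hρ hρδ hβ hrC hrA hC hA hDf hDb hG hD hq
  have hR : 0 ≤ (rC + rA) * (1 + Fintype.card (J ⊕ J)) := mul_nonneg (by positivity) (by positivity)
  have hβX : 0 ≤ β * (1 - β * ((rC + rA) * (1 + Fintype.card (J ⊕ J))) * cr)⁻¹ := mul_nonneg hβ (inv_nonneg.2 (by linarith))
  have hcomp := hasMaj_comp_exp htri hd hrow hmE (mul_nonneg hR hβX) hρ le_rfl hρδ hE hVX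
  have hE' : HasMaj (BlockNorm.ofBlocks g (liftBlk blk ι)) (BlockNorm.ofBlocks g (liftBlk blk ι)) (E ∘ₗ LinearMap.id) (fun y y' => mE * Real.exp (-(ρ * g.dist y y'))) := by
    rw [LinearMap.comp_id]
    exact hE.mono fun a b => mul_le_mul_of_nonneg_left (Real.exp_le_exp.mpr (by nlinarith [hd a b])) hmE
  rw [LinearMap.comp_add]
  refine (hE'.add hcomp).mono fun a b => le_of_eq ?_
  rw [kappa_ofBlocks]
  ring

end Rows

/-! ## §3 By name at `Δ_U + W` -/

section Covariant

variable (η : ℝ) (U : J ⊕ J → X → Matrix ι ι ℝ) (W : (X × ι → ℝ) →ₗ[ℝ] (X × ι → ℝ))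

/-- ★★ **`hloc` MODULO A DEFECT FOR THE DRESSED CUBE PROPAGATOR OF `Δ_U + W`**: `M_χ∘(lapOp η⁻¹ (liftEquiv∘τ) W)∘G₀ = M_χ + E` ⟹ `M_χ∘(Δ_U + W)∘pr₀X̂ = M_χ + E∘(1 + V(c_U, a_U)∘pr₀X̂)`.
[cite: Balaban1984PropagatorsII, (2.91) p.239 (mechanism); Balaban1985BackgroundPropagators, (3.50)–(3.53) p.400, (3.62)–(3.65) pp.402–403] -/
theorem mulOp_comp_covLapM_add_comp_dressed_of_defect (χ : X × ι → ℝ) (E : (X × ι → ℝ) →ₗ[ℝ] (X × ι → ℝ)) {D' : J ⊕ J → (X × ι → ℝ) →ₗ[ℝ] (X × ι → ℝ)}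
    (hloc : mulOp χ ∘ₗ lapOp η⁻¹ (fun μ => liftEquiv (τ μ) ι) W ∘ₗ G₀ = mulOp χ + E) (hDf : ∀ μ, D' (Sum.inl μ) = fgrad η⁻¹ (liftEquiv (τ μ) ι) ∘ₗ G₀)
    (hDb : ∀ μ, D' (Sum.inr μ) = bgrad η⁻¹ (liftEquiv (τ μ) ι) ∘ₗ G₀) (hunit : IsUnit (1 - LinearMap.toMatrix' (stack G₀ D' ∘ₗ unstackM (tCoefC η U) (tCoefA η U)))) :
    mulOp χ ∘ₗ (covLapM τ η U + W) ∘ₗ (projO none ∘ₗ bgPairM G₀ D' (tCoefC η U) (tCoefA η U)) =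
      mulOp χ + E ∘ₗ (LinearMap.id + speciesOpM τ η⁻¹ (tCoefC η U) (tCoefA η U) ∘ₗ (projO none ∘ₗ bgPairM G₀ D' (tCoefC η U) (tCoefA η U))) := by
  rw [covLapM_add_eq_lapOp_sub]
  exact mulOp_comp_sub_speciesOpM_comp_dressed_of_defect τ η⁻¹ (tCoefC η U) (tCoefA η U) _ E χ hloc hDf hDb hunit

variable {g : B6.Geometry} (blk : X → g.Site) {σ cr : ℝ}

/-- ★★ **ENTRY 0 OF THE DRESSED CUBE PROPAGATOR OF `Δ_U + W`, TWO-SIDED LOCALIZED** (FILE 55's `hG` row for the dressed cube at the live background `U`): from the flat cube's entries, its two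
cut-offs `G₀ = M_χG₀ = G₀M_ψ` over `S`, and the transport rows `r_c, r_a`: `pr₀X̂ ≤ 1_S(y)1_S(y′)·β(1 − qc_r)⁻¹·e^{−ρd}` (entries 1: §2 verbatim at `n = η⁻¹`).
[cite: Balaban1985BackgroundPropagators, p.399 («expanding with respect to A»), (3.50)–(3.53) p.400; Balaban1984PropagatorsII, (2.133) p.247 (shape)] -/
theorem hasMaj_dressed_covLapM_add_loc₂ (htri : Triangle254 g) (hd : ∀ a b : g.Site, 0 ≤ g.dist a b) (hrow : RowSum g σ cr) (hσ : 0 ≤ σ) {ρ δ β rC rA : ℝ} (hρ : 0 ≤ ρ)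
    (hρδ : ρ + σ ≤ δ) (hβ : 0 ≤ β) (hrC : 0 ≤ rC) (hrA : 0 ≤ rA) {S : Set g.Site} {χX ψX : X → ℝ} {D' : J ⊕ J → (X × ι → ℝ) →ₗ[ℝ] (X × ι → ℝ)}
    (hSχ : ∀ x, χX x ≠ 0 → blk x ∈ S) (hSψ : ∀ x, ψX x ≠ 0 → blk x ∈ S) (hGχ : mulOp (fun p : X × ι => χX p.1) ∘ₗ G₀ = G₀)
    (hGψ : G₀ ∘ₗ mulOp (fun p : X × ι => ψX p.1) = G₀) (hC : ∀ x i, ∑ k, |tCoefC η U x i k| ≤ rC) (hA : ∀ j x i, ∑ k, |tCoefA η U j x i k| ≤ rA)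
    (hDf : ∀ μ, D' (Sum.inl μ) = fgrad η⁻¹ (liftEquiv (τ μ) ι) ∘ₗ G₀) (hDb : ∀ μ, D' (Sum.inr μ) = bgrad η⁻¹ (liftEquiv (τ μ) ι) ∘ₗ G₀)
    (hG : HasMaj (BlockNorm.ofBlocks g (liftBlk blk ι)) (BlockNorm.ofBlocks g (liftBlk blk ι)) G₀ (fun y y' => β * Real.exp (-(δ * g.dist y y'))))
    (hD : ∀ j, HasMaj (BlockNorm.ofBlocks g (liftBlk blk ι)) (BlockNorm.ofBlocks g (liftBlk blk ι)) (D' j) (fun y y' => β * Real.exp (-(δ * g.dist y y'))))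
    (hq : β * ((rC + rA) * (1 + Fintype.card (J ⊕ J))) * cr < 1) :
    HasMaj (BlockNorm.ofBlocks g (liftBlk blk ι)) (BlockNorm.ofBlocks g (liftBlk blk ι)) (projO none ∘ₗ bgPairM G₀ D' (tCoefC η U) (tCoefA η U))
      (fun y y' => ind S y * ind S y' * (β * (1 - β * ((rC + rA) * (1 + Fintype.card (J ⊕ J))) * cr)⁻¹ * Real.exp (-(ρ * g.dist y y')))) :=
  hasMaj_dressed_loc₂ τ η⁻¹ (tCoefC η U) (tCoefA η U) blk htri hd hrow hσ hρ hρδ hβ hrC hrA hSχ hSψ hGχ hGψ hC hA hDf hDb hG hD hq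

end Covariant

end Summit.QuantumFields.YangMills.BalabanUVNodes.N15.CurvedSpecies

end
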